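import Summits.ResolutionOfSingularities.ResolutionOfSingularities.Theorems.FrobeniusLadderFInjectiveMacaulayficationHypersurfaceOriginNotFull
import Mathlib.Algebra.DualNumber
import HarnessLib

/-!
# R17.11 TIER-1, WITNESS HALF: the `x`-chart of `Bl_𝔮` of the P2d4C specimen `z² + x⁴z + y³ + u³ + t³` (char 2) has a NON-FULL point — the parameter-ideal witness
# (crux `FInjectiveMacaulayfication` stmt-ResolutionOfSingularities-15315, chain w45a; res-L1-w45a-plan-1 RULING R17.11 (2) «KERNEL ✗, TIER 1», SEAT TABLE v31.2 row stub-1;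
# res-L1-w45a-tri-2 REFEREE ANSWER 03:18:48Z (the witness, verbatim); res-L1-w45a-idea-1 FB5-r1 §4.4 (the chart); seat res-L1-w45a-stub-1 g9)

[OURS · L1 W4.5a] Support file (`--supports stmt-ResolutionOfSingularities-15315 --as helper`); replaces the role of NO printed item; NOT a
statement of the manuscript; def-free, unconditional; a CERTIFICATE. AI-written (AI review is weaker than expert review).

## Context
`FCentreCandidate.LFBAdm 2 1 d` («the FIRST Frobenius blow-up `FB₁` FULL-ifies every admissible input») is R ON PAPER at the rung-0 input of the specimen
`X = V(f) ⊂ 𝔸⁵`, `f = z² + x⁴z + y³ + u³ + t³`, `char k = 2` (res-L1-w45a-idea-1 FB5-r1 + res-L1-w45a-tri-2 #360): modulo ONE engine fact (LEMMA N: the Frobenius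
norm ideal of `𝒪_{X,0}` is `c·𝔮⁴`, `𝔮 = (x², y, u, t, z)`), every blow-up demanded by `LFBAdm 2 1 4` is `Bl_𝔮(Spec 𝒪_{X,0})`, whose chart `U_{x²}` is `Spec` of (a localisation of)
`B = k[x, T_y, T_u, T_t, T_z]/(F′)`, `F′ = T_z² + x²T_z + x²(T_y³ + T_u³ + T_t³)` (substitute `y = x²T_y, u = x²T_u, t = x²T_t, z = x²T_z`: `f = x⁴·F′`), and at the chart
origin `P` the crux's stalk clause FAILS. This file is the KERNEL form of that witness (the mathematical core of the ✗); the plumbing half («(c4) ⇒ the blow-up IS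
`Bl_𝔮`», chart ↔ model transport, H1–H5 at the rung-0 input ⇒ `FrobeniusNormP2d4C → ¬ LFBAdm 2 1 4`) is a separate file.

## What is here (variables `X 0 = x`, `X 1 = T_y`, `X 2 = T_u`, `X 3 = T_t`, `X 4 = T_z`; for `f`: `X 0 = x`, `X 1 = y`, `X 2 = u`, `X 3 = t`, `X 4 = z`)
* `theta_chart` — LEMMA E's identity `θ f = x⁴ · F′` for the chart substitution `θ : x ↦ x, (y,u,t,z) ↦ x²·(T_y,T_u,T_t,T_z)`.
* `constantCoeff_chart`, `chart_ne_zero`, `isMaximal_chartOrigin` — the chart origin `P = (x̄, T̄_y, T̄_u, T̄_t, T̄_z)` is a maximal ideal of `B`.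
* ★ `not_fullCl_chartOrigin` — **`¬ FullCl 2 (B_P)`**: `dim B_P = 4` (`HypersurfaceLocalDim`); `𝔮′ = (x̄, T̄_y, T̄_u, T̄_t)·B_P` has `√𝔮′ = 𝔪_P`
  (`T̄_z² = x̄²(T̄_z + ΣT̄³) ∈ 𝔮′` — characteristic 2), so it is a parameter ideal; `T̄_z² ∈ 𝔮′^{[2]}·B_P` (it is a multiple of `x̄²`); and `T̄_z ∉ 𝔮′` (evaluate
  `B_P → k[ε]/(ε²)`, `T_z ↦ ε`, the other variables `↦ 0`: `𝔮′ ↦ 0`, `T̄_z ↦ ε ≠ 0`) — so clause 3 of `FullCl 2` (parameter ideals Frobenius closed) FAILS at `P`.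
* `p2d4c_vertex_not_fullCl` — the rung-0 input itself is a BAD point: `f = z·z + x²·x²z + y·y² + u·u² + t·t² ∈ 𝔪^{[2]}` (`HypersurfaceOriginNotFull.not_fullCl_stalk_origin_of_fedder_mem`),
  together with `prime_f` (`T² + C(x⁴)·T + C(y³+u³+t³)` Eisenstein at `(0,1,1,0)`) and `constantCoeff_f`.

[folklore mathematics, OURS as a certificate; cite: Fedder1983, Prop. 1.7; Yasuda2012, Def. 2.2 (F-blowups, context only)]
-/

-- single-problem summit: the doubled namespace component is forced
set_option linter.dupNamespace false

noncomputable section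

open AlgebraicGeometry CategoryTheory Literature.AlgebraicGeometry.Resolution TopologicalSpace IsLocalRing MvPolynomial
open scoped DualNumber

namespace Summit.ResolutionOfSingularities.ResolutionOfSingularities.Theorems.FInjectiveMacaulayfication.FCentreE1ChartWitness

open Summit.ResolutionOfSingularities.ResolutionOfSingularities.Theorems.FInjectiveMacaulayfication
open SliceableCentre

/-! ## §1 LEMMA E's chart identity -/

/-- **`θ f = x⁴ · F′`** for `f = z² + x⁴z + y³ + u³ + t³`, `θ : x ↦ x, y ↦ x²T_y, u ↦ x²T_u, t ↦ x²T_t, z ↦ x²T_z` (the `x²`-chart of `Bl_𝔮`, `𝔮 = (x², y, u, t, z)`),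
`F′ = T_z² + x²T_z + x²(T_y³ + T_u³ + T_t³)`. [folklore] -/
theorem theta_chart (k : Type) [Field k] (f F' : MvPolynomial (Fin 5) k)
    (hf : f = X 4 ^ 2 + X 0 ^ 4 * X 4 + X 1 ^ 3 + X 2 ^ 3 + X 3 ^ 3)
    (hF : F' = X 4 ^ 2 + X 0 ^ 2 * X 4 + X 0 ^ 2 * (X 1 ^ 3 + X 2 ^ 3 + X 3 ^ 3)) :
    aeval (fun j : Fin 5 => if j = 0 then (X 0 : MvPolynomial (Fin 5) k) else X 0 ^ 2 * X j) f = X 0 ^ 4 * F' := by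
  rw [hf, hF]
  simp only [map_add, map_mul, map_pow, aeval_X, Fin.isValue, if_true, show (4 : Fin 5) ≠ 0 by decide, show (1 : Fin 5) ≠ 0 by decide,
    show (2 : Fin 5) ≠ 0 by decide, show (3 : Fin 5) ≠ 0 by decide, if_false]
  ring

/-! ## §2 The chart ring `B = k[x, T]/(F′)` and its origin -/

/-- `F′(0) = 0`. [folklore] -/
theorem constantCoeff_chart (k : Type) [Field k] (F' : MvPolynomial (Fin 5) k)
    (hF : F' = X 4 ^ 2 + X 0 ^ 2 * X 4 + X 0 ^ 2 * (X 1 ^ 3 + X 2 ^ 3 + X 3 ^ 3)) : constantCoeff F' = 0 := by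
  rw [hF]
  simp [constantCoeff_X]

/-- `F′ ≠ 0` (its value at `T_z = 1`, all other variables `0`, is `1`). [folklore] -/
theorem chart_ne_zero (k : Type) [Field k] (F' : MvPolynomial (Fin 5) k)
    (hF : F' = X 4 ^ 2 + X 0 ^ 2 * X 4 + X 0 ^ 2 * (X 1 ^ 3 + X 2 ^ 3 + X 3 ^ 3)) : F' ≠ 0 := by
  intro h0
  have h := congrArg (MvPolynomial.eval (Pi.single (4 : Fin 5) (1 : k))) h0
  rw [hF, map_zero] at h
  simp only [map_add, map_mul, map_pow, eval_X, Pi.single_eq_same, Pi.single_eq_of_ne (show (0 : Fin 5) ≠ 4 by decide),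
    one_pow, zero_pow two_ne_zero, zero_mul, add_zero] at h
  exact one_ne_zero h

/-- The chart origin `(x̄, T̄_y, T̄_u, T̄_t, T̄_z)` is a maximal ideal of `B = k[x,T]/(F′)`. [folklore] -/
theorem isMaximal_chartOrigin (k : Type) [Field k] (F' : MvPolynomial (Fin 5) k)
    (hF : F' = X 4 ^ 2 + X 0 ^ 2 * X 4 + X 0 ^ 2 * (X 1 ^ 3 + X 2 ^ 3 + X 3 ^ 3)) :
    (Ideal.span (Set.range fun j : Fin 5 => Ideal.Quotient.mk (Ideal.span {F'}) (X j))).IsMaximal :=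
  DoublePointFermatCubicGerm.isMaximal_origin k F' (constantCoeff_chart k F' hF)

/-! ## §3 The parameter-ideal witness: the chart origin is NOT a FULL point -/

set_option maxHeartbeats 800000 in
-- one localization lift + several ideal-membership computations
/-- ★ **`¬ FullCl 2 (B_P)` at the chart origin `P` of `B = k[x, T_y, T_u, T_t, T_z]/(F′)`**, `F′ = T_z² + x²T_z + x²(T_y³ + T_u³ + T_t³)`, `char k = 2`. Witness
(res-L1-w45a-tri-2 03:18:48Z): `dim B_P = 4`; `𝔮′ = (x̄, T̄_y, T̄_u, T̄_t)` is a parameter ideal (`T̄_z² = x̄²·(T̄_z + ΣT̄³) ∈ 𝔮′`, so `√𝔮′ = 𝔪_P`); `T̄_z² ∈ 𝔮′^{[2]}B_P` (a multiple of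
`x̄²`); but `T̄_z ∉ 𝔮′B_P` — the evaluation `B_P → k[ε]/(ε²)`, `T_z ↦ ε`, other variables `↦ 0`, kills `𝔮′` and sends `T̄_z` to `ε ≠ 0`. Hence the parameter ideal `𝔮′B_P` is NOT
Frobenius closed: clause 3 of `SliceableCentre.FullCl 2` fails. [cite: Fedder1983, Prop. 1.7 (context)] -/
theorem not_fullCl_chartOrigin (k : Type) [Field k] [CharP k 2] (F' : MvPolynomial (Fin 5) k)
    (hF : F' = X 4 ^ 2 + X 0 ^ 2 * X 4 + X 0 ^ 2 * (X 1 ^ 3 + X 2 ^ 3 + X 3 ^ 3))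
    (Q : Ideal (MvPolynomial (Fin 5) k ⧸ Ideal.span {F'})) [Q.IsPrime]
    (hQ : Q = Ideal.span (Set.range fun j : Fin 5 => Ideal.Quotient.mk (Ideal.span {F'}) (X j))) :
    ¬ FullCl 2 (Localization.AtPrime Q) := by
  classical
  intro hfull
  -- notation
  set R := MvPolynomial (Fin 5) k ⧸ Ideal.span {F'} with hR
  set mk : MvPolynomial (Fin 5) k →+* R := Ideal.Quotient.mk (Ideal.span {F'}) with hmk
  set L := Localization.AtPrime Q with hL
  set alg : R →+* L := algebraMap R L with halg
  haveI hQmax : Q.IsMaximal := by rw [hQ]; exact isMaximal_chartOrigin k F' hF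
  -- (1) the dimension
  have hdim : ringKrullDim L = (4 : ℕ) :=
    HypersurfaceLocalDim.stub_hypersurfaceLocalDim k 4 F' (chart_ne_zero k F' hF) Q
  -- the relation `T̄_z² = x̄² · (T̄_z + ΣT̄³)` in `R` (characteristic 2: `-a = a`)
  have h2 : (2 : MvPolynomial (Fin 5) k) = 0 := (FermatCubicConeChar2.two_three k (n := 5)).1
  have hrel : mk (X 4) ^ 2 = mk (X 0) ^ 2 * (mk (X 4) + (mk (X 1) ^ 3 + mk (X 2) ^ 3 + mk (X 3) ^ 3)) := by
    have hF0 : mk F' = 0 := Ideal.Quotient.eq_zero_iff_mem.mpr (Ideal.mem_span_singleton_self F')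
    have e : (X 4 : MvPolynomial (Fin 5) k) ^ 2 =
        X 0 ^ 2 * (X 4 + (X 1 ^ 3 + X 2 ^ 3 + X 3 ^ 3)) - F' + 2 * (X 4 ^ 2) := by rw [hF]; ring
    rw [h2, zero_mul, add_zero] at e
    have := congrArg mk e
    rwa [map_sub, hF0, sub_zero, map_pow, map_mul, map_pow, map_add, map_add, map_add, map_pow, map_pow, map_pow] at this
  -- (2) the system of parameters `s = (x̄, T̄_y, T̄_u, T̄_t)` of `L`
  set s : Fin 4 → L := fun j => alg (mk (X (Fin.castSucc j))) with hs
  have hsx : ∀ j : Fin 4, alg (mk (X (Fin.castSucc j))) ∈ Ideal.span (Set.range s) := fun j => Ideal.subset_span ⟨j, rfl⟩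
  have hx0 : alg (mk (X 0)) ∈ Ideal.span (Set.range s) := hsx 0
  -- `T̄_z² ∈ (s)` and indeed `∈ (s)^{[2]}`
  have hTz2 : alg (mk (X 4)) ^ 2 = alg (mk (X 0)) ^ 2 * alg (mk (X 4) + (mk (X 1) ^ 3 + mk (X 2) ^ 3 + mk (X 3) ^ 3)) := by
    rw [← map_pow, hrel, map_mul, map_pow]
  have hTz2mem : alg (mk (X 4)) ^ 2 ∈ Ideal.span (Set.range s) := by
    rw [hTz2, pow_two, mul_assoc]
    exact Ideal.mul_mem_right _ _ hx0
  -- `√(s) = 𝔪_L`, hence maximal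
  have hmaxL : IsLocalRing.maximalIdeal L = Q.map alg := (Localization.AtPrime.map_eq_maximalIdeal (I := Q)).symm
  have hle : Ideal.span (Set.range s) ≤ IsLocalRing.maximalIdeal L := by
    rw [Ideal.span_le]
    rintro _ ⟨j, rfl⟩
    rw [hmaxL]
    refine Ideal.mem_map_of_mem _ ?_
    rw [hQ]
    exact Ideal.subset_span ⟨Fin.castSucc j, rfl⟩
  have hgen : ∀ j : Fin 5, alg (mk (X j)) ∈ (Ideal.span (Set.range s)).radical := by
    intro j
    -- the five generators: `x̄, T̄_y, T̄_u, T̄_t` lie in `(s)`, `T̄_z` has its square in `(s)`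
    by_cases hj : j = 4
    · subst hj
      exact ⟨2, hTz2mem⟩
    · have hj' : (j : ℕ) < 4 := by
        have := j.isLt
        have hne : (j : ℕ) ≠ 4 := fun h => hj (Fin.ext h)
        omega
      have hcast : Fin.castSucc (⟨j, hj'⟩ : Fin 4) = j := Fin.ext rfl
      exact Ideal.le_radical (hcast ▸ hsx ⟨j, hj'⟩)
  have hrad_eq : (Ideal.span (Set.range s)).radical = IsLocalRing.maximalIdeal L := by
    apply le_antisymm
    · exact (Ideal.radical_mono hle).trans_eq (IsLocalRing.maximalIdeal.isMaximal L).isPrime.radical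
    · rw [hmaxL]
      refine Ideal.map_le_iff_le_comap.mpr fun q hq => ?_
      have hq' : q ∈ Ideal.span (Set.range fun j : Fin 5 => mk (X j)) := hQ ▸ hq
      refine (Ideal.span_le.mpr ?_) hq'
      rintro _ ⟨j, rfl⟩
      rw [SetLike.mem_coe, Ideal.mem_comap]
      exact hgen j
  have hrad : (Ideal.span (Set.range s)).radical.IsMaximal := by
    rw [hrad_eq]
    exact IsLocalRing.maximalIdeal.isMaximal L
  -- (3) apply clause 3 of `FullCl 2` to `y = T̄_z`, `e = 1`
  obtain ⟨-, hclause⟩ := hfull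
  have hF3 := (hclause 4 hdim s hrad).2 (alg (mk (X 4))) ⟨1, by
    rw [pow_one, hTz2]
    exact Ideal.mul_mem_right _ _ (Ideal.subset_span ⟨alg (mk (X 0)), hx0, by simp⟩)⟩
  -- (4) `T̄_z ∉ (s)`: evaluate into the dual numbers `k[ε]`
  let v : Fin 5 → k[ε] := fun j => if j = 4 then ε else 0
  have hφF : aeval v F' = 0 := by
    rw [hF]
    simp only [map_add, map_mul, map_pow, aeval_X, v, if_true, show (0 : Fin 5) ≠ 4 by decide, if_false, DualNumber.eps_pow_two,
      zero_pow two_ne_zero, zero_mul, add_zero]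
  let φ₁ : R →+* k[ε] := Ideal.Quotient.lift (Ideal.span {F'}) (aeval v).toRingHom fun a ha => by
    obtain ⟨c, rfl⟩ := Ideal.mem_span_singleton.mp ha
    change aeval v (F' * c) = 0
    rw [map_mul, hφF, zero_mul]
  have hφ₁ : ∀ g : MvPolynomial (Fin 5) k, φ₁ (mk g) = aeval v g := fun g => Ideal.Quotient.lift_mk _ _ _
  -- elements off `Q` go to units (their constant coefficient survives as the first component)
  have hfst : ∀ g : MvPolynomial (Fin 5) k, TrivSqZeroExt.fst (aeval v g) = constantCoeff g := by
    intro g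
    have hcomp : (TrivSqZeroExt.fstHom k k k).comp (aeval v) = aeval (fun j => TrivSqZeroExt.fst (v j)) := by
      ext j
      simp
    have hv0 : (fun j => TrivSqZeroExt.fst (v j)) = (0 : Fin 5 → k) := by
      funext j
      by_cases hj : j = 4 <;> simp [v, hj, DualNumber.fst_eps]
    have := congrArg (fun ψ => ψ g) hcomp
    simp only [AlgHom.comp_apply] at this
    change TrivSqZeroExt.fst (aeval v g) = _ at this
    rw [this, hv0, MvPolynomial.aeval_zero]
    rfl
  have hunit : ∀ y : Q.primeCompl, IsUnit (φ₁ y) := by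
    rintro ⟨y, hy⟩
    obtain ⟨g, rfl⟩ := Ideal.Quotient.mk_surjective y
    change IsUnit (φ₁ (mk g))
    rw [hφ₁, TrivSqZeroExt.isUnit_iff_isUnit_fst, hfst, isUnit_iff_ne_zero]
    intro hc
    apply hy
    change mk g ∈ Q
    have hg : g ∈ Q.comap mk := by
      rw [hQ, DoublePointFermatCubicGerm.comap_origin k F' (constantCoeff_chart k F' hF), Fedder.span_range_X_eq_ker, RingHom.mem_ker]
      exact hc
    exact hg
  let ψ : L →+* k[ε] := IsLocalization.lift (M := Q.primeCompl) (g := φ₁) hunit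
  have hψ : ∀ r : R, ψ (alg r) = φ₁ r := fun r => IsLocalization.lift_eq (M := Q.primeCompl) hunit r
  -- `ψ` kills `(s)` …
  have hψs : ∀ w ∈ Ideal.span (Set.range s), ψ w = 0 := by
    intro w hw
    have hmap : Ideal.span (Set.range s) ≤ RingHom.ker ψ := by
      rw [Ideal.span_le]
      rintro _ ⟨j, rfl⟩
      rw [SetLike.mem_coe, RingHom.mem_ker, hs]
      change ψ (alg (mk (X (Fin.castSucc j)))) = 0
      rw [hψ, hφ₁, aeval_X]
      have : (Fin.castSucc j : Fin 5) ≠ 4 := fun h => by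
        have := congrArg Fin.val h
        simp at this
        omega
      simp [v, this]
    exact hmap hw
  -- … but not `T̄_z ↦ ε`
  have hε : ψ (alg (mk (X 4))) = ε := by rw [hψ, hφ₁, aeval_X]; simp [v]
  have h0 := hψs _ hF3
  rw [hε] at h0
  have := congrArg TrivSqZeroExt.snd h0
  rw [DualNumber.snd_eps, TrivSqZeroExt.snd_zero] at this
  exact one_ne_zero this

/-! ## §4 The rung-0 input is a BAD point (and the specimen is a prime hypersurface) -/

/-- `f = z² + x⁴z + y³ + u³ + t³` has no constant term. [folklore] -/
theorem constantCoeff_f (k : Type) [Field k] (f : MvPolynomial (Fin 5) k)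
    (hf : f = X 4 ^ 2 + X 0 ^ 4 * X 4 + X 1 ^ 3 + X 2 ^ 3 + X 3 ^ 3) : constantCoeff f = 0 := by
  rw [hf]
  simp [constantCoeff_X]

/-- **`f = z² + x⁴z + y³ + u³ + t³` is PRIME in characteristic 2**: as `T² + C(x⁴)·T + C(y³ + u³ + t³)` over `k[x, y, u, t]` (`z ↦ T`), Eisenstein at the point
`(x, y, u, t) = (0, 1, 1, 0)` where `x⁴ = 0`, `y³ + u³ + t³ = 2 = 0` and `∂/∂y = 3y² = 1 ≠ 0` (`irreducible_X_pow_add_C_mul_X_add_C`). [folklore] -/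
theorem prime_f (k : Type) [Field k] [CharP k 2] (f : MvPolynomial (Fin 5) k)
    (hf : f = X 4 ^ 2 + X 0 ^ 4 * X 4 + X 1 ^ 3 + X 2 ^ 3 + X 3 ^ 3) : Prime f := by
  -- move `z = X 4` to the front: `k[X₀..X₄] ≃ k[Y₀..Y₃][T]` with `X 4 ↦ T`, `X j ↦ C (Y j)` (`j ≤ 3`)
  set e : MvPolynomial (Fin 5) k ≃+* Polynomial (MvPolynomial (Fin 4) k) :=
    ((renameEquiv k (_root_.finRotate 5)).trans (finSuccEquiv k 4)).toRingEquiv with he_def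
  have hrot4 : (_root_.finRotate 5) (4 : Fin 5) = 0 := by decide
  have hrot : ∀ j : Fin 4, (_root_.finRotate 5) (Fin.castSucc j) = j.succ := by decide
  have he4 : e (X 4) = Polynomial.X := by
    show finSuccEquiv k 4 (rename _ (X 4)) = _
    rw [rename_X, hrot4]; exact finSuccEquiv_X_zero
  have hej : ∀ j : Fin 4, e (X (Fin.castSucc j)) = Polynomial.C (X j) := fun j => by
    show finSuccEquiv k 4 (rename _ (X (Fin.castSucc j))) = _
    rw [rename_X, hrot j]; exact finSuccEquiv_X_succ (j := j)
  set b : MvPolynomial (Fin 4) k := X 0 ^ 4 with hb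
  set c : MvPolynomial (Fin 4) k := X 1 ^ 3 + X 2 ^ 3 + X 3 ^ 3 with hc
  have hef : e f = Polynomial.X ^ 2 + Polynomial.C b * Polynomial.X + Polynomial.C c := by
    rw [hf, map_add, map_add, map_add, map_add, map_pow, map_mul, map_pow, he4, map_pow, map_pow, map_pow,
      show (0 : Fin 5) = Fin.castSucc (0 : Fin 4) from rfl, show (1 : Fin 5) = Fin.castSucc (1 : Fin 4) from rfl,
      show (2 : Fin 5) = Fin.castSucc (2 : Fin 4) from rfl, show (3 : Fin 5) = Fin.castSucc (3 : Fin 4) from rfl, hej, hej, hej, hej, hb, hc]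
    simp only [map_add, map_pow]
    ring
  -- the point `a = (0, 1, 1, 0)`
  set a : Fin 4 → k := ![0, 1, 1, 0] with ha
  have h2 : (2 : k) = 0 := by simpa using CharP.cast_eq_zero k 2
  have hba : MvPolynomial.eval a b = 0 := by rw [hb, map_pow, eval_X, ha]; simp
  have hca : MvPolynomial.eval a c = 0 := by
    rw [hc]
    simp only [map_add, map_pow, eval_X, ha, Matrix.cons_val_zero, Matrix.cons_val_one]
    simp only [Matrix.cons_val, one_pow, zero_pow three_ne_zero, add_zero]
    rw [show (1 : k) + 1 = 2 by norm_num, h2]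
  have hder : MvPolynomial.eval a (pderiv 1 c) ≠ 0 := by
    have e1 : pderiv 1 c = 3 * X 1 ^ 2 := by
      rw [hc, map_add, map_add, pderiv_pow, pderiv_X_self, pderiv_pow, pderiv_X_of_ne (show (2 : Fin 4) ≠ 1 by decide),
        pderiv_pow, pderiv_X_of_ne (show (3 : Fin 4) ≠ 1 by decide)]
      push_cast
      ring
    rw [e1, map_mul, map_pow, eval_X, ha]
    simp only [Matrix.cons_val_one, Matrix.cons_val_zero, one_pow, mul_one]
    rw [show (MvPolynomial.eval ![(0 : k), 1, 1, 0]) 3 = (2 : k) + 1 by rw [map_ofNat]; norm_num, h2, zero_add]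
    exact one_ne_zero
  have hirr : Irreducible (e f) := by
    rw [hef]
    exact Literature.AlgebraicGeometry.Motives.SmoothHypersurface.irreducible_X_pow_add_C_mul_X_add_C (d := 2) le_rfl b c a hba hca 1 hder
  exact (MulEquiv.prime_iff e).mp hirr.prime

/-- **The rung-0 input of R17.11 is a BAD point**: at the vertex `v` of `X = V(z² + x⁴z + y³ + u³ + t³)` (char 2) the stalk is NOT FULL —
`f = z·z + (x²)·x²z + y·y² + u·u² + t·t² ∈ 𝔪^{[2]}` (Fedder necessity, `HypersurfaceOriginNotFull.not_fullCl_stalk_origin_of_fedder_mem`). [cite: Fedder1983, Prop. 1.7] -/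
theorem p2d4c_vertex_not_fullCl (k : Type) [Field k] [CharP k 2] (f : MvPolynomial (Fin 5) k)
    (hf : f = X 4 ^ 2 + X 0 ^ 4 * X 4 + X 1 ^ 3 + X 2 ^ 3 + X 3 ^ 3)
    (v : Spec (.of (MvPolynomial (Fin 5) k ⧸ Ideal.span {f})))
    (hv : v.asIdeal = Ideal.span (Set.range fun j : Fin 5 => Ideal.Quotient.mk (Ideal.span {f}) (X j))) :
    ¬ FullCl 2 ((Spec (.of (MvPolynomial (Fin 5) k ⧸ Ideal.span {f}))).presheaf.stalk v) := by
  haveI : Fact (Nat.Prime 2) := ⟨Nat.prime_two⟩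
  refine HypersurfaceOriginNotFull.not_fullCl_stalk_origin_of_fedder_mem 2 k f (prime_f k f hf).ne_zero (constantCoeff_f k f hf) ?_ v hv
  rw [show (2 - 1 : ℕ) = 1 from rfl, pow_one, hf]
  have hsq : ∀ j : Fin 5, (X j : MvPolynomial (Fin 5) k) ^ 2 ∈ Ideal.span (Set.range fun i : Fin 5 => (X i : MvPolynomial (Fin 5) k) ^ 2) :=
    fun j => Ideal.subset_span ⟨j, rfl⟩
  refine Ideal.add_mem _ (Ideal.add_mem _ (Ideal.add_mem _ (Ideal.add_mem _ (hsq 4) ?_) ?_) ?_) ?_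
  · rw [show (X 0 : MvPolynomial (Fin 5) k) ^ 4 * X 4 = X 0 ^ 2 * (X 0 ^ 2 * X 4) by ring]
    exact Ideal.mul_mem_right _ _ (hsq 0)
  all_goals
    rw [pow_succ']
    exact Ideal.mul_mem_left _ _ (hsq _)

end Summit.ResolutionOfSingularities.ResolutionOfSingularities.Theorems.FInjectiveMacaulayfication.FCentreE1ChartWitness

end
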